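import Mathlib.Data.Nat.Nth
import Mathlib.Data.Set.Countable
import Mathlib.Data.Set.Card
import Mathlib.Data.Prod.Lex
import Mathlib.Algebra.Order.Archimedean.Real.Basic
import HarnessLib

/-!
# Sorting a locally finite real family (`stub_sortedEnumeration`)

Stub `stub_sortedEnumeration` of the line `defect-compactness-design` (wave 2, structure of
witnesses) for the crux `WindowTraceArch` (stmt-RiemannHypothesis-11195; skeleton
`Summit.RiemannHypothesis.RiemannHypothesis.Cruxes.WindowTraceArch.DefectCompactnessDesign`).

**Statement.** Let `γ : ι → ℝ` be a family such that every set `{i | |γ i| ≤ R}` is finite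
(local finiteness) and such that `P := {i | 0 ≤ γ i}` is infinite. Then there is an injective
`e : ℕ → ι` with `Set.range e = P` and `n ↦ γ (e n)` monotone (non-decreasing): the non-negative
part of the family can be sorted.

**Proof.** `P` is countable, being covered by the finite sets `{i | |γ i| ≤ n}`, `n : ℕ`; fix a map
`c : ι → ℕ` injective on `P` and the lexicographic key `key i := (γ i, c i) ∈ ℝ ×ₗ ℕ`, injective on
`P`. For every `i` the strict initial segment `lower i := {j ∈ P | key j < key i}` is contained in
`{j | |γ j| ≤ γ i}`, hence finite, so the rank `r i := #(lower i) ∈ ℕ` is defined; `r` is strictly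
increasing along `key` on `P` (if `i ∈ P` and `key i < key j` then `lower i ⊊ lower j`, the element
`i` witnessing strictness), hence injective on `P`, and `r i ≤ r j`, `j ∈ P`, forces `γ i ≤ γ j`.
The image `r '' P ⊆ ℕ` is infinite; `Nat.nth` enumerates it strictly increasingly and exhaustively,
and pulling back along `r` (`Function.invFunOn`) gives `e`: injective because `Nat.nth` is,
exhaustive because `Set.range (Nat.nth _) = r '' P`, and monotone because `r ∘ e = Nat.nth _` is.
(No transfinite recursion and no surjectivity of the rank onto `ℕ` is needed.)

**Sources.** Elementary order theory: a countable linear order with finite initial segments embeds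
in `ℕ` by rank; Mathlib's `Nat.nth`, `Set.ncard`, `Prod.Lex`, `Set.countable_iff_exists_injOn`.
[folklore]
-/

set_option linter.dupNamespace false

noncomputable section

open Set

namespace Summit.RiemannHypothesis.RiemannHypothesis.Theorems.SpectralTraceWindowTraceArch

/-- **stub_sortedEnumeration — sorting a locally finite family.** A family `γ : ι → ℝ` all of
whose sets `{i : |γ i| ≤ R}` are finite and which has infinitely many indices with `γ i ≥ 0` admits
an injective `e : ℕ → ι` enumerating exactly those indices in non-decreasing order of `γ`. Proof:
rank the indices `i` with `γ i ≥ 0` by the (finite) number of such indices strictly below `i` for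
the lexicographic key `(γ i, c i)` (`c` a tie-breaking injection into `ℕ`, which exists because the
index set is a countable union of finite sets); the rank is injective and `γ`-monotone, its image in
`ℕ` is infinite, and composing the increasing enumeration `Nat.nth` of the image with the inverse of
the rank gives `e`. [folklore] -/
theorem stub_sortedEnumeration :
    ∀ (ι : Type) (γ : ι → ℝ), (∀ R : ℝ, {i : ι | |γ i| ≤ R}.Finite) → {i : ι | 0 ≤ γ i}.Infinite →
      ∃ e : ℕ → ι, Function.Injective e ∧ Set.range e = {i : ι | 0 ≤ γ i} ∧ Monotone (fun n => γ (e n)) := by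
  intro ι γ hfin hinf
  obtain ⟨i₀, -⟩ := hinf.nonempty
  haveI : Nonempty ι := ⟨i₀⟩
  set P : Set ι := {i : ι | 0 ≤ γ i} with hP
  -- `P` is countable: it is covered by the finite sets `{i | |γ i| ≤ n}`, `n : ℕ`
  have hPc : P.Countable := by
    refine (Set.countable_iUnion fun n : ℕ => (hfin n).countable).mono ?_
    intro i hi
    have h0 : 0 ≤ γ i := hi
    obtain ⟨n, hn⟩ := exists_nat_ge (γ i)
    refine Set.mem_iUnion.2 ⟨n, ?_⟩
    show |γ i| ≤ n
    rwa [abs_of_nonneg h0]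
  -- a tie-breaking map `c : ι → ℕ`, injective on `P`, and the lexicographic key `(γ i, c i)`
  obtain ⟨c, hc⟩ := Set.countable_iff_exists_injOn.1 hPc
  let key : ι → ℝ ×ₗ ℕ := fun i => toLex (γ i, c i)
  have hkey_inj : Set.InjOn key P := fun i hi j hj h =>
    hc hi hj (congrArg (fun p : ℝ ×ₗ ℕ => (ofLex p).2) h)
  have hkey_fst : ∀ {i j : ι}, key i < key j → γ i ≤ γ j := fun h => by
    rcases Prod.Lex.toLex_lt_toLex.1 h with h | ⟨h, _⟩
    exacts [h.le, h.le]
  have hkey_lt : ∀ {i j : ι}, γ i < γ j → key i < key j := fun h =>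
    Prod.Lex.toLex_lt_toLex.2 (Or.inl h)
  -- strict initial segments inside `P` are finite
  let lower : ι → Set ι := fun i => {j | j ∈ P ∧ key j < key i}
  have hlower_fin : ∀ i, (lower i).Finite := fun i => by
    refine (hfin (γ i)).subset ?_
    rintro j ⟨hjP, hji⟩
    have h0 : 0 ≤ γ j := hjP
    show |γ j| ≤ γ i
    rw [abs_of_nonneg h0]
    exact hkey_fst hji
  -- the rank `r i = #{j ∈ P | key j < key i}`: strictly `key`-monotone on `P`, injective on `P`,
  -- and `γ`-monotone
  let r : ι → ℕ := fun i => (lower i).ncard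
  have hr_lt : ∀ {i j : ι}, i ∈ P → key i < key j → r i < r j := fun {i j} hi hij => by
    refine Set.ncard_lt_ncard ⟨?_, fun h => ?_⟩ (hlower_fin j)
    · rintro l ⟨hlP, hli⟩
      exact ⟨hlP, hli.trans hij⟩
    · exact lt_irrefl _ (h ⟨hi, hij⟩).2
  have hr_inj : Set.InjOn r P := fun i hi j hj h => by
    by_contra hne
    rcases lt_or_gt_of_ne (fun hk => hne (hkey_inj hi hj hk)) with hk | hk
    · exact absurd h (hr_lt hi hk).ne
    · exact absurd h (hr_lt hj hk).ne'
  have hr_mono : ∀ {i j : ι}, j ∈ P → r i ≤ r j → γ i ≤ γ j := fun {i j} hj h => by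
    by_contra hlt
    exact absurd h (not_le.2 (hr_lt hj (hkey_lt (not_le.1 hlt))))
  -- the image `r '' P ⊆ ℕ` is infinite; enumerate it increasingly by `Nat.nth` and pull back
  have hSinf : (setOf fun k => k ∈ r '' P).Infinite := (Set.infinite_image_iff hr_inj).2 hinf
  have hmemS : ∀ n, ∃ a ∈ P, r a = Nat.nth (fun k => k ∈ r '' P) n := fun n =>
    Nat.nth_mem_of_infinite hSinf n
  set e : ℕ → ι := fun n => Function.invFunOn r P (Nat.nth (fun k => k ∈ r '' P) n) with he
  have he_mem : ∀ n, e n ∈ P := fun n => Function.invFunOn_mem (hmemS n)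
  have he_eq : ∀ n, r (e n) = Nat.nth (fun k => k ∈ r '' P) n := fun n =>
    Function.invFunOn_eq (hmemS n)
  refine ⟨e, ?_, ?_, ?_⟩
  · intro n m h
    apply (Nat.nth_strictMono hSinf).injective
    rw [← he_eq n, ← he_eq m]
    exact congrArg r h
  · ext i
    refine ⟨?_, fun hi => ?_⟩
    · rintro ⟨n, rfl⟩
      exact he_mem n
    · have hri : r i ∈ Set.range (Nat.nth fun k => k ∈ r '' P) := by
        rw [Nat.range_nth_of_infinite hSinf]
        exact ⟨i, hi, rfl⟩
      obtain ⟨n, hn⟩ := hri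
      exact ⟨n, hr_inj (he_mem n) hi ((he_eq n).trans hn)⟩
  · intro n m hnm
    refine hr_mono (he_mem m) ?_
    rw [he_eq n, he_eq m]
    exact (Nat.nth_strictMono hSinf).monotone hnm

end Summit.RiemannHypothesis.RiemannHypothesis.Theorems.SpectralTraceWindowTraceArch

end
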